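import Mathlib.Analysis.InnerProductSpace.PiL2
import Literature.Analysis.Convexity.SignArrangementChainComplex
import Literature.Topology.FourManifolds.PLManifoldComp
import HarnessLib

/-!
# Cells of an arrangement adapted to a box and to finitely many simplices

Elementary tools for the extension step of the triangulation programme (Munkres (1966) 10.4:
"the cell complex of the box cut by the hyperplanes containing the faces of the straight
simplices").  For a family of affine functionals `L : ι → E →ᵃ[ℝ] ℝ`:

* `cellSet L J Z = {x | (∀ j ∈ J, 0 ≤ L j x) ∧ ∀ j ∈ Z, L j x = 0}` — the closed "cell" cut out
  by the functionals in `J` (weak inequalities) and `Z` (equations); a face of the sign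
  arrangement of `L` which meets it lies in it (`face_subset_cellSet`), and so does the closed
  face (`cl_subset_cellSet`);
* closed simplices (and their faces) of affine bases whose coordinate functionals are among the
  `L` are such sets (`convexHull_image_eq_cellSet`), and a vertex is by itself a face
  (`face_svec_eq_singleton`);
* `exists_cellComplex` — for finitely many bounded cells there is a finite geometric simplicial
  complex (the chain complex of the faces inside the cells) covering them, each simplex inside one
  cell, refining every sub-cell simplexwise, and having every arrangement vertex of the region as
  a vertex of each simplex containing it; `exists_cellComplex₂` adds that a simplex has at most one
  arrangement vertex among its vertices.

No named facts are introduced. [folklore]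
-/

open Set Function

noncomputable section

namespace Literature.Topology.FourManifolds

open Literature.Analysis.Convexity Literature.Analysis.Convexity.SignArrangement

section CellSet

variable {E : Type*} [AddCommGroup E] [Module ℝ E] {ι : Type*}

/-- The closed cell `{x | (∀ j ∈ J, 0 ≤ L j x) ∧ ∀ j ∈ Z, L j x = 0}`. [folklore] -/
def cellSet (L : ι → E →ᵃ[ℝ] ℝ) (J Z : Set ι) : Set E := {x | (∀ j ∈ J, 0 ≤ L j x) ∧ ∀ j ∈ Z, L j x = 0}

variable {L : ι → E →ᵃ[ℝ] ℝ} {J Z : Set ι} {ε : ι → SignType}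

/-- Auxiliary (`mem_cellSet_iff`). [folklore] -/
theorem mem_cellSet_iff {x : E} : x ∈ cellSet L J Z ↔ (∀ j ∈ J, 0 ≤ L j x) ∧ ∀ j ∈ Z, L j x = 0 :=
  Iff.rfl

/-- Sign bookkeeping: equal signs and a nonnegative value give a nonnegative value. [folklore] -/
theorem nonneg_of_sign_eq {a b : ℝ} (h : SignType.sign a = SignType.sign b) (hb : 0 ≤ b) : 0 ≤ a := by
  by_contra hneg
  push Not at hneg
  rw [sign_neg hneg] at h
  rcases hb.lt_or_eq with hpos | h0
  · rw [sign_pos hpos] at h; exact absurd h (by decide)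
  · rw [← h0, sign_zero] at h; exact absurd h (by decide)

/-- **Dichotomy**: a face of the arrangement meeting the cell lies in it (signs are constant on
faces). [folklore] -/
theorem face_subset_cellSet (h : (face L ε ∩ cellSet L J Z).Nonempty) : face L ε ⊆ cellSet L J Z := by
  obtain ⟨x, hx, hxJ, hxZ⟩ := h
  intro y hy
  have hs : ∀ j, SignType.sign (L j y) = SignType.sign (L j x) := fun j => by
    have h1 := congr_fun (mem_face_iff.1 hy) j
    have h2 := congr_fun (mem_face_iff.1 hx) j
    rw [svec_apply] at h1 h2
    rw [h1, h2]
  refine ⟨fun j hj => nonneg_of_sign_eq (hs j) (hxJ j hj), fun j hj => ?_⟩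
  have h := hs j
  rw [hxZ j hj, sign_zero, sign_eq_zero_iff] at h
  exact h

/-- The closed face of a face meeting the cell lies in it as well (the cell is described by weak
inequalities and equations, preserved under `SLE`). [folklore] -/
theorem cl_subset_cellSet (h : (face L ε ∩ cellSet L J Z).Nonempty) : cl L ε ⊆ cellSet L J Z := by
  obtain ⟨x, hx, hxJ, hxZ⟩ := h
  intro y hy
  have hface := mem_face_iff.1 hx
  refine ⟨fun j hj => ?_, fun j hj => ?_⟩
  · rcases (mem_cl_iff_sle.1 hy) j with h0 | heq
    · rw [svec_apply, sign_eq_zero_iff] at h0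
      exact h0.ge
    · have h2 := congr_fun hface j
      rw [svec_apply] at heq h2
      rw [← h2] at heq
      exact nonneg_of_sign_eq heq (hxJ j hj)
  · rcases (mem_cl_iff_sle.1 hy) j with h0 | heq
    · rw [svec_apply, sign_eq_zero_iff] at h0
      exact h0
    · have h2 := congr_fun hface j
      rw [svec_apply] at heq h2
      rw [← h2, hxZ j hj, sign_zero, sign_eq_zero_iff] at heq
      exact heq

/-- A face disjoint from the cell, or inside it. [folklore] -/
theorem face_subset_or_disjoint_cellSet (ε : ι → SignType) (J Z : Set ι) :
    face L ε ⊆ cellSet L J Z ∨ Disjoint (face L ε) (cellSet L J Z) := by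
  by_cases h : (face L ε ∩ cellSet L J Z).Nonempty
  · exact Or.inl (face_subset_cellSet h)
  · exact Or.inr (disjoint_iff_inter_eq_empty.2 (not_nonempty_iff_eq_empty.1 h))

end CellSet

section Simplex

variable {E : Type*} [NormedAddCommGroup E] [NormedSpace ℝ E]
  {ι κ : Type*} [Fintype κ]

/-- **Faces of a simplex are cells**: for an affine basis `β` whose coordinate functionals are
`L ∘ e`, the closed face of `β` on the vertex set `S` is the cell of the inequalities
`0 ≤ coord k` (all `k`) and the equations `coord k = 0` (`k ∉ S`). [folklore] -/
theorem convexHull_image_eq_cellSet (β : AffineBasis κ ℝ E) {L : ι → E →ᵃ[ℝ] ℝ} (e : κ → ι)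
    (hL : ∀ k, L (e k) = β.coord k) (S : Set κ) :
    convexHull ℝ (β '' S) = cellSet L (Set.range e) (e '' Sᶜ) := by
  ext x
  rw [mem_convexHull_image_affineBasis_iff β S x, mem_cellSet_iff]
  constructor
  · rintro ⟨hpos, hzero⟩
    refine ⟨?_, ?_⟩
    · rintro _ ⟨k, rfl⟩
      rw [hL]; exact hpos k
    · rintro _ ⟨k, hk, rfl⟩
      rw [hL]; exact hzero k hk
  · rintro ⟨hpos, hzero⟩
    refine ⟨fun k => ?_, fun k hk => ?_⟩
    · have := hpos (e k) ⟨k, rfl⟩; rwa [hL] at this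
    · have := hzero (e k) ⟨k, hk, rfl⟩; rwa [hL] at this

/-- **A vertex of such a simplex is a face by itself.** [folklore] -/
theorem face_svec_eq_singleton (β : AffineBasis κ ℝ E) {L : ι → E →ᵃ[ℝ] ℝ} (e : κ → ι)
    (hL : ∀ k, L (e k) = β.coord k) (k₀ : κ) : face L (svec L (β k₀)) = {β k₀} := by
  classical
  refine Subset.antisymm (fun y hy => ?_) (fun y hy => by rw [mem_singleton_iff.1 hy]; exact mem_face_svec _)
  rw [mem_singleton_iff]
  -- all coordinates of `y` but the `k₀`-th vanish
  have hcoord : ∀ k, k ≠ k₀ → β.coord k y = 0 := fun k hk => by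
    have h := congr_fun (mem_face_iff.1 hy) (e k)
    rw [svec_apply, svec_apply, hL, AffineBasis.coord_apply_ne β hk, sign_zero, sign_eq_zero_iff] at h
    exact h
  have hk₀ : β.coord k₀ y = 1 := by
    have hsum := β.sum_coord_apply_eq_one y
    rw [← Finset.add_sum_erase _ _ (Finset.mem_univ k₀)] at hsum
    rw [Finset.sum_eq_zero (fun k hk => hcoord k (Finset.ne_of_mem_erase hk)), add_zero] at hsum
    exact hsum
  refine β.ext_elem fun k => ?_
  by_cases hk : k = k₀
  · subst hk; rw [hk₀, AffineBasis.coord_apply_eq]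
  · rw [hcoord k hk, AffineBasis.coord_apply_ne β hk]

end Simplex

section CellComplex

variable {E : Type*} [NormedAddCommGroup E] [NormedSpace ℝ E] [FiniteDimensional ℝ E]
  {ι : Type*} [Fintype ι] [DecidableEq E]

omit [FiniteDimensional ℝ E] in
/-- A vertex of an affinely independent configuration lying in the closed simplex of a
sub-configuration belongs to it. [folklore] -/
theorem mem_of_mem_convexHull_of_subset {τ σ : Finset E} (hτ : AffineIndependent ℝ ((↑) : τ → E))
    (hσ : σ ⊆ τ) {p : E} (hp : p ∈ τ) (hpσ : p ∈ convexHull ℝ (σ : Set E)) : p ∈ σ := by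
  classical
  have h := hτ.convexHull_inter (Finset.singleton_subset_iff.2 hp) hσ
  have hp' : p ∈ convexHull ℝ (({p} : Finset E) : Set E) ∩ convexHull ℝ (σ : Set E) :=
    ⟨subset_convexHull ℝ _ (by simp), hpσ⟩
  rw [← h] at hp'
  by_contra hne
  have : (({p} : Finset E) ∩ σ : Finset E) = ∅ := by
    ext q; simp only [Finset.mem_inter, Finset.mem_singleton, Finset.notMem_empty, iff_false, not_and]
    rintro rfl; exact hne
  rw [← Finset.coe_inter, this, Finset.coe_empty, convexHull_empty] at hp'
  exact hp'

/-- **The cell complex of finitely many bounded cells** (Munkres (1966) 7.7–7.9 for the cells of a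
box cut by hyperplanes).  For affine functionals `L` and finitely many bounded cells
`cellSet L (J α) (Z α)` there is a finite geometric simplicial complex `P` with: every cell is
covered by `P`; every simplex of `P` lies in one of the cells; every point of the cells lying in
an arbitrary cell `cellSet L J' Z'` lies in a simplex of `P` inside that cell; and a point of the
cells which is by itself a face of the arrangement is a vertex of every simplex of `P` containing
it. [cite: Munkres1966, Lemma 7.8] -/
theorem exists_cellComplex (L : ι → E →ᵃ[ℝ] ℝ) {A : Type*} [Finite A] (J Z : A → Set ι)
    (hbdd : ∀ α, Bornology.IsBounded (cellSet L (J α) (Z α))) :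
    ∃ P : Geometry.SimplicialComplex ℝ E, P.faces.Finite ∧
      (∀ α, cellSet L (J α) (Z α) ⊆ P.space) ∧
      (∀ τ ∈ P.faces, ∃ α, convexHull ℝ (τ : Set E) ⊆ cellSet L (J α) (Z α)) ∧
      (∀ x, (∃ α, x ∈ cellSet L (J α) (Z α)) → ∀ J' Z' : Set ι, x ∈ cellSet L J' Z' →
        ∃ τ ∈ P.faces, x ∈ convexHull ℝ (τ : Set E) ∧ convexHull ℝ (τ : Set E) ⊆ cellSet L J' Z') ∧
      (∀ p, (∃ α, p ∈ cellSet L (J α) (Z α)) → face L (svec L p) = {p} →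
        ∀ τ ∈ P.faces, p ∈ convexHull ℝ (τ : Set E) → p ∈ τ) := by
  classical
  -- the faces inside the cells
  set Φ : Finset (ι → SignType) := Finset.univ.filter fun ε =>
    (face L ε).Nonempty ∧ ∃ α, face L ε ⊆ cellSet L (J α) (Z α) with hΦ
  have hmemΦ : ∀ ε, ε ∈ Φ ↔ (face L ε).Nonempty ∧ ∃ α, face L ε ⊆ cellSet L (J α) (Z α) := fun ε => by
    simp [hΦ]
  -- chosen points
  have hch : ∀ ε : ι → SignType, ∃ p : E, ε ∈ Φ → p ∈ face L ε := fun ε => by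
    by_cases h : ε ∈ Φ
    · obtain ⟨p, hp⟩ := ((hmemΦ ε).1 h).1
      exact ⟨p, fun _ => hp⟩
    · exact ⟨0, fun h' => (h h').elim⟩
  choose b hb using hch
  -- down-closedness and boundedness
  have hcl : ∀ ε ∈ Φ, ∃ α, cl L ε ⊆ cellSet L (J α) (Z α) := fun ε hε => by
    obtain ⟨⟨p, hp⟩, α, hα⟩ := (hmemΦ ε).1 hε
    exact ⟨α, cl_subset_cellSet ⟨p, hp, hα hp⟩⟩
  have hdown : ∀ ε ∈ Φ, ∀ ε', SLE ε' ε → (face L ε').Nonempty → ε' ∈ Φ := fun ε hε ε' hle hne => by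
    obtain ⟨α, hα⟩ := hcl ε hε
    exact (hmemΦ ε').2 ⟨hne, α, (face_subset_cl.trans (cl_mono hle)).trans hα⟩
  have hbdd' : ∀ ε ∈ Φ, Bornology.IsBounded (cl L ε) := fun ε hε => by
    obtain ⟨α, hα⟩ := hcl ε hε
    exact (hbdd α).subset hα
  -- the chain complex
  set P := chainComplex L Φ b hb with hP
  have hsvec : ∀ x, (∃ α, x ∈ cellSet L (J α) (Z α)) → svec L x ∈ Φ := fun x ⟨α, hx⟩ =>
    (hmemΦ _).2 ⟨⟨x, mem_face_svec x⟩, α, face_subset_cellSet ⟨x, mem_face_svec x, hx⟩⟩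
  refine ⟨P, chainComplex_faces_finite, fun α x hx => ?_, fun τ hτ => ?_, fun x hx J' Z' hxc => ?_,
    fun p hp hface τ hτ hpτ => ?_⟩
  · exact face_subset_chainComplex_space hdown hbdd' (hsvec x ⟨α, hx⟩) (mem_face_svec x)
  · obtain ⟨ε, hε, -, hsub⟩ := convexHull_subset_cl_of_mem_chainComplex_faces hτ
    obtain ⟨α, hα⟩ := hcl ε hε
    exact ⟨α, hsub.trans hα⟩
  · obtain ⟨τ, hτ, -, hxτ, hsub⟩ := exists_face_of_mem_face hdown hbdd' (hsvec x hx) (mem_face_svec x)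
    exact ⟨τ, hτ, hxτ, hsub.trans (cl_subset_cellSet ⟨x, mem_face_svec x, hxc⟩)⟩
  · -- `p = b (svec p)` is a vertex of a simplex `τ₀ ∋ p`; compare with `τ`
    have hε := hsvec p hp
    have hbp : b (svec L p) = p := by
      have h := hb _ hε
      rw [hface] at h
      exact mem_singleton_iff.1 h
    obtain ⟨τ₀, hτ₀, hpτ₀, hpconv, -⟩ := exists_face_of_mem_face (b := b) (hb := hb) hdown hbdd' hε (mem_face_svec p)
    rw [hbp] at hpτ₀
    -- `p ∈ conv τ ∩ conv τ₀ ⊆ conv (τ ∩ τ₀)`, and `p` is a vertex of `τ₀`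
    have hinter : p ∈ convexHull ℝ (↑(τ₀ ∩ τ) : Set E) := by
      rw [Finset.coe_inter]
      exact P.inter_subset_convexHull hτ₀ hτ ⟨hpconv, hpτ⟩
    have hmem := mem_of_mem_convexHull_of_subset (P.indep hτ₀) Finset.inter_subset_left hpτ₀ hinter
    exact (Finset.mem_inter.1 hmem).2

/-- **The cell complex, with uniqueness of arrangement vertices in a simplex.** As
`exists_cellComplex`, with the additional property that a simplex of `P` has at most one vertex
which is by itself a face of the arrangement (two such vertices of a chain simplex are chosen
points of comparable singleton faces, hence equal). [cite: Munkres1966, Lemma 7.8] -/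
theorem exists_cellComplex₂ (L : ι → E →ᵃ[ℝ] ℝ) {A : Type*} [Finite A] (J Z : A → Set ι)
    (hbdd : ∀ α, Bornology.IsBounded (cellSet L (J α) (Z α))) :
    ∃ P : Geometry.SimplicialComplex ℝ E, P.faces.Finite ∧
      (∀ α, cellSet L (J α) (Z α) ⊆ P.space) ∧
      (∀ τ ∈ P.faces, ∃ α, convexHull ℝ (τ : Set E) ⊆ cellSet L (J α) (Z α)) ∧
      (∀ x, (∃ α, x ∈ cellSet L (J α) (Z α)) → ∀ J' Z' : Set ι, x ∈ cellSet L J' Z' →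
        ∃ τ ∈ P.faces, x ∈ convexHull ℝ (τ : Set E) ∧ convexHull ℝ (τ : Set E) ⊆ cellSet L J' Z') ∧
      (∀ p, (∃ α, p ∈ cellSet L (J α) (Z α)) → face L (svec L p) = {p} →
        ∀ τ ∈ P.faces, p ∈ convexHull ℝ (τ : Set E) → p ∈ τ) ∧
      (∀ τ ∈ P.faces, ∀ p ∈ τ, ∀ q ∈ τ, face L (svec L p) = {p} → face L (svec L q) = {q} → p = q) := by
  classical
  -- the faces inside the cells
  set Φ : Finset (ι → SignType) := Finset.univ.filter fun ε =>
    (face L ε).Nonempty ∧ ∃ α, face L ε ⊆ cellSet L (J α) (Z α) with hΦ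
  have hmemΦ : ∀ ε, ε ∈ Φ ↔ (face L ε).Nonempty ∧ ∃ α, face L ε ⊆ cellSet L (J α) (Z α) := fun ε => by
    simp [hΦ]
  -- chosen points
  have hch : ∀ ε : ι → SignType, ∃ p : E, ε ∈ Φ → p ∈ face L ε := fun ε => by
    by_cases h : ε ∈ Φ
    · obtain ⟨p, hp⟩ := ((hmemΦ ε).1 h).1
      exact ⟨p, fun _ => hp⟩
    · exact ⟨0, fun h' => (h h').elim⟩
  choose b hb using hch
  -- down-closedness and boundedness
  have hcl : ∀ ε ∈ Φ, ∃ α, cl L ε ⊆ cellSet L (J α) (Z α) := fun ε hε => by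
    obtain ⟨⟨p, hp⟩, α, hα⟩ := (hmemΦ ε).1 hε
    exact ⟨α, cl_subset_cellSet ⟨p, hp, hα hp⟩⟩
  have hdown : ∀ ε ∈ Φ, ∀ ε', SLE ε' ε → (face L ε').Nonempty → ε' ∈ Φ := fun ε hε ε' hle hne => by
    obtain ⟨α, hα⟩ := hcl ε hε
    exact (hmemΦ ε').2 ⟨hne, α, (face_subset_cl.trans (cl_mono hle)).trans hα⟩
  have hbdd' : ∀ ε ∈ Φ, Bornology.IsBounded (cl L ε) := fun ε hε => by
    obtain ⟨α, hα⟩ := hcl ε hε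
    exact (hbdd α).subset hα
  -- the chain complex
  set P := chainComplex L Φ b hb with hP
  have hsvec : ∀ x, (∃ α, x ∈ cellSet L (J α) (Z α)) → svec L x ∈ Φ := fun x ⟨α, hx⟩ =>
    (hmemΦ _).2 ⟨⟨x, mem_face_svec x⟩, α, face_subset_cellSet ⟨x, mem_face_svec x, hx⟩⟩
  -- the face of a chosen point is its sign face
  have hface_b : ∀ ε ∈ Φ, svec L (b ε) = ε := fun ε hε => mem_face_iff.1 (hb ε hε)
  refine ⟨P, chainComplex_faces_finite, fun α x hx => ?_, fun τ hτ => ?_, fun x hx J' Z' hxc => ?_,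
    fun p hp hface τ hτ hpτ => ?_, fun τ hτ p hp q hq hfp hfq => ?_⟩
  · exact face_subset_chainComplex_space hdown hbdd' (hsvec x ⟨α, hx⟩) (mem_face_svec x)
  · obtain ⟨ε, hε, -, hsub⟩ := convexHull_subset_cl_of_mem_chainComplex_faces hτ
    obtain ⟨α, hα⟩ := hcl ε hε
    exact ⟨α, hsub.trans hα⟩
  · obtain ⟨τ, hτ, -, hxτ, hsub⟩ := exists_face_of_mem_face hdown hbdd' (hsvec x hx) (mem_face_svec x)
    exact ⟨τ, hτ, hxτ, hsub.trans (cl_subset_cellSet ⟨x, mem_face_svec x, hxc⟩)⟩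
  · have hε := hsvec p hp
    have hbp : b (svec L p) = p := by
      have h := hb _ hε
      rw [hface] at h
      exact mem_singleton_iff.1 h
    obtain ⟨τ₀, hτ₀, hpτ₀, hpconv, -⟩ := exists_face_of_mem_face (b := b) (hb := hb) hdown hbdd' hε (mem_face_svec p)
    rw [hbp] at hpτ₀
    have hinter : p ∈ convexHull ℝ (↑(τ₀ ∩ τ) : Set E) := by
      rw [Finset.coe_inter]
      exact P.inter_subset_convexHull hτ₀ hτ ⟨hpconv, hpτ⟩
    have hmem := mem_of_mem_convexHull_of_subset (P.indep hτ₀) Finset.inter_subset_left hpτ₀ hinter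
    exact (Finset.mem_inter.1 hmem).2
  · -- two arrangement vertices of a chain simplex coincide
    obtain ⟨C, hCΦ, -, hC, rfl⟩ := (mem_chainComplex_faces (hb := hb)).1 hτ
    obtain ⟨ε, hε, rfl⟩ := Finset.mem_image.1 hp
    obtain ⟨ε', hε', rfl⟩ := Finset.mem_image.1 hq
    have hsv : svec L (b ε) = ε := hface_b ε (hCΦ hε)
    have hsv' : svec L (b ε') = ε' := hface_b ε' (hCΦ hε')
    rw [hsv] at hfp
    rw [hsv'] at hfq
    -- singleton faces are closed: `cl = closure face = face`
    have hclε : cl L ε = {b ε} := by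
      rw [cl_eq_closure_face (hb ε (hCΦ hε)), hfp, closure_singleton]
    have hclε' : cl L ε' = {b ε'} := by
      rw [cl_eq_closure_face (hb ε' (hCΦ hε')), hfq, closure_singleton]
    rcases total_of_isChain hC hε hε' with hle | hle
    · have h : b ε ∈ cl L ε' := cl_mono hle (face_subset_cl (hb ε (hCΦ hε)))
      rw [hclε'] at h
      exact mem_singleton_iff.1 h
    · have h : b ε' ∈ cl L ε := cl_mono hle (face_subset_cl (hb ε' (hCΦ hε')))
      rw [hclε] at h
      exact (mem_singleton_iff.1 h).symm

end CellComplex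


end Literature.Topology.FourManifolds
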